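import Summits.QuantumFields.YangMills.Theorems.LangevinControlUVOSLegsFromFemtoAndGapStubAssemblyPlaneExpansion
import HarnessLib

/-!
# `FBL6 ⇒ FBL` (crux `OSLegsAtWeakCouplingC`, stmt-QuantumFields-16207, line `Sketch` — skeleton glue)

Helper file for the lead skeleton `Cruxes/OSLegsAtWeakCouplingC/Lines/Sketch.lean`: the plane-resolved femto
boundary law `FBL6` (output of the import `stub_fcp6`) implies the density boundary law `FBL` consumed by the landed
`stub_lower`, with constant `6C₁` and reference value `Σ_{i<j} p (i,j) β` — the action density is the sum of the six
single-plane fields (`dens_eq_sum_filter_plane`) and the cube kernel `kerE` (tree `ymSpecification`) is linear.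
-/

set_option autoImplicit false

noncomputable section

open scoped BigOperators
open MeasureTheory Filter Topology
open Literature.MathematicalPhysics.QuantumFieldTheory Literature.MathematicalPhysics.QuantumLattice
open Literature.MathematicalPhysics.AQFT Literature.Probability.LatticeModels
open Summit.QuantumFields.YangMills.Theorems.OSLegsFromFemtoAndGap (dens_eq_sum_filter_plane card_planes)

namespace Summit.QuantumFields.YangMills.Cruxes.OSLegsFromFemtoAndGap.DlrCollarTransfer

/-- **`FBL6 ⇒ FBL`** with constant `6C₁` and reference value `Σ_{i<j} p (i,j) β`: the action density is the sum of
the six single-plane fields (`dens_eq_sum_filter_plane`) and the cube kernel is linear. [folklore] -/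
theorem fbl_of_fbl6 : ∀ {G : Type} [Group G] [TopologicalSpace G] [IsTopologicalGroup G] [CompactSpace G] [MeasurableSpace G] [BorelSpace G] (r : LatticeRep G) (a : ℝ → ℝ), FBL6 G r a → FBL G r a := by
  intro G _ _ _ _ _ _ r a h
  classical
  obtain ⟨C₁, β₁, ℓ₁, p, hℓ, hC, H⟩ := h
  set P : Finset (Fin 4 × Fin 4) := Finset.univ.filter (fun q : Fin 4 × Fin 4 => q.1 < q.2) with hP
  refine ⟨6 * C₁, β₁, ℓ₁, fun β => ∑ q ∈ P, p q β, hℓ, by positivity, ?_⟩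
  intro β hβ c b hb η x hx
  haveI : SecondCountableTopology G :=
    (r.continuous.isClosedEmbedding r.injective).isEmbedding.secondCountableTopology
  haveI := isProbabilityMeasure_ymSpecification r.ρ r.continuous β (cubeEdges c b) η
  obtain ⟨CA, hCA⟩ := exists_abs_plane_le (G := G) r
  have hint : ∀ q : Fin 4 × Fin 4,
      Integrable (plane G r q x) (ymSpecification (d := 4) r.ρ β (cubeEdges c b) η) := fun q =>
    Integrable.of_bound (C := CA) (continuous_plane r q x).measurable.aestronglyMeasurable
      (Eventually.of_forall fun U => by rw [Real.norm_eq_abs]; exact hCA q x U)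
  have hsum : kerE G r β c b η (dens G r x) = ∑ q ∈ P, kerE G r β c b η (plane G r q x) := by
    unfold kerE
    rw [← integral_finsetSum _ (fun q _ => hint q)]
    exact integral_congr_ae (Eventually.of_forall fun U => dens_eq_sum_filter_plane r x U)
  rw [hsum, ← Finset.sum_sub_distrib]
  calc |∑ q ∈ P, (kerE G r β c b η (plane G r q x) - p q β)|
      ≤ ∑ q ∈ P, |kerE G r β c b η (plane G r q x) - p q β| := Finset.abs_sum_le_sum_abs _ _
    _ ≤ ∑ _q ∈ P, C₁ / (depth c b x : ℝ) ^ 4 :=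
        Finset.sum_le_sum fun q hq => H β hβ c b hb η q x (by rw [hP, Finset.mem_filter] at hq; exact hq.2) hx
    _ = 6 * C₁ / (depth c b x : ℝ) ^ 4 := by
        rw [Finset.sum_const, hP, card_planes, nsmul_eq_mul]
        push_cast
        ring

end Summit.QuantumFields.YangMills.Cruxes.OSLegsFromFemtoAndGap.DlrCollarTransfer

end
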